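import Summits.CriticalPhenomena.PercolationContinuityZ3.Theorems.PercLowPointHalfSpaceTallClusterMassBoundArrowOneThreshold
import Summits.CriticalPhenomena.PercolationContinuityZ3.Theorems.PercLowPointHalfSpaceTallClusterMassBoundWallArmPartial
import Literature.Barriers.CriticalPhenomena.KozmaNachmiasLemma11Steps

/-!
# `TallClusterMassBound` (stmt-CriticalPhenomena-0912), line `onesided-halves` — the `ρ = 1` slice of stub G:
# at `p_c(ℤ³)` the typical maximum of the half-box grows at least linearly, `M(Λ_r) ≥ r/96`

Stub G (`stub_typicalMaxPolyGrowth`) of the skeleton `Cruxes/TallClusterMassBound/Lines/onesided_halves.lean` asks for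
`c (r/ρ)^κ M(Λ_ρ) ≤ M(Λ_r)` for all `1 ≤ ρ ≤ r`, where `M(Λ_r) = typicalMax P^ℍ_{p_c} Λ_r` is Hutchcroft's typical value
of the largest cluster trace `|K_max(Λ_r)|` of bond percolation on the INDUCED half-space `P^ℍ_{p_c} =
floorDilutedPercolation 3 p_c 1` in `Λ_r = halfBox r = B_r ∩ ℍ`. This file proves its `ρ = 1` slice — the part of G
that follows from criticality "from above" by first moments:

  `typicalMax_halfBox_ge_linear : (r : ℝ) / 96 ≤ M(Λ_r)` for every `r`, and the registered form
  `typicalMax_halfBox_linear_lower : ∃ c > 0, ∀ r ≥ 1, c r ≤ M(Λ_r)`.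

Ingredients (all in the tree): Kozma–Nachmias Lemma 3.1 at `p_c` in the Duminil-Copin–Tassion form
`Σ_{z ∈ ∂B_k} P_{p_c}(0 ↔ z in B_k) ≥ 1/6` (`Literature.Barriers.CriticalPhenomena.sum_sphere_real_openConnIn_ge`, from
`φ_{p_c}(B_k) ≥ 1`), summed over the shells: `Σ_{x ∈ B_t} P_{p_c}(0 ↔ x in B_t) ≥ t/6` (§1); translation to the bulk point
`v = up t = (t,0,0)` of `Λ_r` (`t = ⌊r/2⌋`, so `v + B_t ⊆ Λ_r ⊆ ℍ`; `real_openConnIn_shift_box`) and the bridge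
`P^ℍ = P_{p_c}` on connections inside `ℍ` (`floorDilutedPercolation_one_openConnIn`) (§2); counting,
`E^ℍ|K_max(Λ_r)| ≥ E^ℍ|K_v ∩ Λ_r| ≥ t/6` (§3); finally Hutchcroft's `E|K_max(Λ)| ≤ 4 M(Λ)`
(`integral_clusterMaxIn_le_four_mul_typicalMax`) and `M ≥ 2` give `M(Λ_r) ≥ max(2, (r-1)/48) ≥ r/96` (§4).
This is far from G (relative growth across scales needs a merging mechanism); it records the absolute floor that
criticality provides. No Theses statement is touched; no definitions.
-/

noncomputable section

open MeasureTheory Finset Filter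
open Literature.Probability.Percolation Literature.Probability.LatticeModels
open Summit.CriticalPhenomena.PercolationContinuityZ3.Theorems.TallClusterMassBound.Negative
open Summit.CriticalPhenomena.PercolationContinuityZ3.Theorems.TallClusterMassBound.TightnessLine
open Literature.Barriers.CriticalPhenomena (sum_sphere_real_openConnIn_ge real_openConnIn_shift_box
  mem_image_zdShiftIso_box_iff)

namespace Summit.CriticalPhenomena.PercolationContinuityZ3.Theorems.TallClusterMassBound.OnesidedHalves

/-! ## §1 The ball bound `Σ_{x ∈ B_t} P_{p_c}(0 ↔ x in B_t) ≥ t/6` -/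

/-- **Ball bound at `p_c(ℤ³)`**: `E_{p_c}|{x ∈ B_t : 0 ↔ x in B_t}| = Σ_{x ∈ B_t} P_{p_c}(0 ↔ x in B_t) ≥ t/6`
(sum the shell bounds `Σ_{z ∈ ∂B_{n+1}} P_{p_c}(0 ↔ z in B_{n+1}) ≥ 1/6`; `{0 ↔ x in B_n} ⊆ {0 ↔ x in B_{n+1}}`).
[folklore] -/
theorem ball_twoPointIn_sum_ge (t : ℕ) :
    (t : ℝ) / 6 ≤ ∑ x ∈ box 3 t, (bondPercolation (zdGraph 3) (criticalProbI 3)).real (openConnIn (↑(box 3 t)) 0 x) := by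
  set P := bondPercolation (zdGraph 3) (criticalProbI 3) with hP
  have hp : criticalProb (zdGraph 3) (0 : V3) ≤ ((criticalProbI 3 : unitInterval) : ℝ) :=
    le_of_eq (coe_criticalProbI 3).symm
  induction t with
  | zero =>
    simp only [Nat.cast_zero, zero_div]
    exact Finset.sum_nonneg fun _ _ => measureReal_nonneg
  | succ n ih =>
    have hsub : box 3 n ⊆ box 3 (n + 1) := box_mono 3 (Nat.le_succ n)
    have hcoe : (↑(box 3 n) : Set V3) ⊆ ↑(box 3 (n + 1)) := Finset.coe_subset.2 hsub
    rw [← Finset.sum_sdiff hsub]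
    have hmono : ∑ x ∈ box 3 n, P.real (openConnIn (↑(box 3 n)) 0 x) ≤
        ∑ x ∈ box 3 n, P.real (openConnIn (↑(box 3 (n + 1))) 0 x) :=
      Finset.sum_le_sum fun x _ => measureReal_mono (openConnIn_mono hcoe 0 x) (measure_ne_top _ _)
    have hshell : (1 : ℝ) / (2 * (3 : ℕ)) ≤
        ∑ x ∈ box 3 (n + 1) \ box 3 n, P.real (openConnIn (↑(box 3 (n + 1))) 0 x) := by
      rw [← sphere_succ_eq_sdiff]
      exact sum_sphere_real_openConnIn_ge (d := 3) (by norm_num) (criticalProbI 3) hp (n + 1)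
    push_cast at hshell ⊢
    linarith

/-! ## §2 Translation to a bulk point of the half-box, and the bridge `P^ℍ = P_{p_c}` inside `ℍ` -/

/-- The translate `up t + B_t` lies in the half-space `ℍ`. [folklore] -/
theorem shift_box_subset_Hs (t : ℕ) : ⇑(zdShiftIso (up t)) '' (↑(box 3 t) : Set V3) ⊆ {x : V3 | 0 ≤ x 0} := by
  intro z hz
  have hz' : z - up t ∈ box 3 t := mem_image_zdShiftIso_box_iff.1 hz
  rw [mem_box] at hz'
  have h0 := hz' 0
  simp only [Pi.sub_apply, up_apply_zero] at h0
  simp only [Set.mem_setOf_eq]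
  omega

/-- The translate `up t + B_t` lies in the half-box `Λ_r` when `2t ≤ r`. [folklore] -/
theorem shift_box_subset_halfBox {t r : ℕ} (h : 2 * t ≤ r) :
    ⇑(zdShiftIso (up t)) '' (↑(box 3 t) : Set V3) ⊆ ↑(halfBox r) := by
  intro z hz
  have hz' : z - up t ∈ box 3 t := mem_image_zdShiftIso_box_iff.1 hz
  rw [mem_box] at hz'
  rw [Finset.mem_coe, halfBox, Finset.mem_filter, mem_box]
  have h0 := hz' 0
  simp only [Pi.sub_apply, up_apply_zero] at h0
  refine ⟨fun i => ?_, by omega⟩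
  have hi := hz' i
  by_cases hi0 : i = 0
  · subst hi0
    omega
  · have hup : up t i = 0 := by simp [up, hi0]
    simp only [Pi.sub_apply, hup, sub_zero] at hi
    omega

/-- **Bridge + translation**: `P^ℍ_{p_c}(v ↔ y + v in v + B_t) = P_{p_c}(0 ↔ y in B_t)` for `v = up t`
(`v + B_t ⊆ ℍ`, `floorDilutedPercolation_one_openConnIn`, `real_openConnIn_shift_box`). [folklore] -/
theorem floorDiluted_real_openConnIn_shift_box (y : V3) (t : ℕ) :
    (floorDilutedPercolation 3 (criticalProbI 3) 1).real
        (openConnIn (⇑(zdShiftIso (up t)) '' (↑(box 3 t) : Set V3)) (up t) (y + up t)) =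
      (bondPercolation (zdGraph 3) (criticalProbI 3)).real (openConnIn (↑(box 3 t)) 0 y) := by
  rw [← real_openConnIn_shift_box (criticalProbI 3) (up t) y t, measureReal_def, measureReal_def,
    floorDilutedPercolation_one_openConnIn (criticalProbI 3) (shift_box_subset_Hs t)]

/-! ## §3 Counting: the restricted connections from `v` are vertices of `K_v ∩ Λ_r` -/

/-- Pointwise, for `2t ≤ r` and `v = up t`:
`Σ_{y ∈ B_t} 𝟙{v ↔ y + v in v + B_t} ≤ |K_v ∩ Λ_r| ≤ |K_max(Λ_r)|`. [folklore] -/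
theorem sum_indicator_openConnIn_le_clusterMaxIn {t r : ℕ} (h : 2 * t ≤ r) (ω : BondConfig V3) :
    ∑ y ∈ box 3 t, (openConnIn (⇑(zdShiftIso (up t)) '' (↑(box 3 t) : Set V3)) (up t)
        (y + up t)).indicator (fun _ => (1 : ℝ)) ω ≤ (clusterMaxIn (halfBox r) ω : ℝ) := by
  classical
  set B : Set V3 := ⇑(zdShiftIso (up t)) '' (↑(box 3 t) : Set V3) with hB
  have hsum : ∑ y ∈ box 3 t, (openConnIn B (up t) (y + up t)).indicator (fun _ => (1 : ℝ)) ω =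
      (((box 3 t).filter fun y => ω ∈ openConnIn B (up t) (y + up t)).card : ℝ) := by
    rw [← Finset.sum_boole]
    refine Finset.sum_congr rfl fun y _ => ?_
    by_cases hy : ω ∈ openConnIn B (up t) (y + up t)
    · rw [Set.indicator_of_mem hy, if_pos hy]
    · rw [Set.indicator_of_notMem hy, if_neg hy]
  rw [hsum]
  have hcard : ((box 3 t).filter fun y => ω ∈ openConnIn B (up t) (y + up t)).card ≤
      clusterCapIn (halfBox r) ω (up t) := by
    rw [clusterCapIn_eq]
    refine Finset.card_le_card_of_injOn (fun y => y + up t) (fun y hy => ?_) ?_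
    · rw [Finset.mem_coe, Finset.mem_filter] at hy
      rw [Finset.mem_coe, Finset.mem_filter]
      refine ⟨?_, openConnIn_subset_openConn B (up t) _ hy.2⟩
      exact shift_box_subset_halfBox h ⟨y, Finset.mem_coe.2 hy.1, zdShiftIso_apply (up t) y⟩
    · intro y _ y' _ hyy'
      exact add_right_cancel hyy'
  have hmax : clusterCapIn (halfBox r) ω (up t) ≤ clusterMaxIn (halfBox r) ω := clusterCapIn_le_clusterMaxIn' _ _ _
  exact_mod_cast hcard.trans hmax

/-- **`E^ℍ_{p_c}|K_max(Λ_r)| ≥ t/6` for `2t ≤ r`.** [folklore] -/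
theorem integral_clusterMaxIn_halfBox_ge {t r : ℕ} (h : 2 * t ≤ r) :
    (t : ℝ) / 6 ≤ ∫ ω, (clusterMaxIn (halfBox r) ω : ℝ) ∂(floorDilutedPercolation 3 (criticalProbI 3) 1) := by
  set P := floorDilutedPercolation 3 (criticalProbI 3) 1 with hP
  set B : Set V3 := ⇑(zdShiftIso (up t)) '' (↑(box 3 t) : Set V3) with hB
  have hmeas : ∀ y ∈ box 3 t, MeasurableSet (openConnIn B (up t) (y + up t)) :=
    fun y _ => measurableSet_openConnIn_of_countable B (up t) _
  have hint : ∀ y ∈ box 3 t,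
      Integrable (fun ω => (openConnIn B (up t) (y + up t)).indicator (fun _ => (1 : ℝ)) ω) P :=
    fun y hy => (integrable_const (1 : ℝ)).indicator (hmeas y hy)
  calc (t : ℝ) / 6 ≤ ∑ y ∈ box 3 t, (bondPercolation (zdGraph 3) (criticalProbI 3)).real (openConnIn (↑(box 3 t)) 0 y) :=
        ball_twoPointIn_sum_ge t
    _ = ∑ y ∈ box 3 t, P.real (openConnIn B (up t) (y + up t)) :=
        Finset.sum_congr rfl fun y _ => (floorDiluted_real_openConnIn_shift_box y t).symm
    _ = ∑ y ∈ box 3 t, ∫ ω, (openConnIn B (up t) (y + up t)).indicator (fun _ => (1 : ℝ)) ω ∂P := by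
        refine Finset.sum_congr rfl fun y hy => ?_
        rw [integral_indicator_const _ (hmeas y hy), smul_eq_mul, mul_one]
    _ = ∫ ω, ∑ y ∈ box 3 t, (openConnIn B (up t) (y + up t)).indicator (fun _ => (1 : ℝ)) ω ∂P :=
        (integral_finsetSum _ hint).symm
    _ ≤ ∫ ω, (clusterMaxIn (halfBox r) ω : ℝ) ∂P :=
        integral_mono (integrable_finsetSum _ hint) (integrable_clusterMaxIn P (halfBox r))
          fun ω => sum_indicator_openConnIn_le_clusterMaxIn h ω

/-! ## §4 The linear lower bound on the typical maximum -/

/-- **`M(Λ_r) ≥ r/96` at `p_c(ℤ³)`** (all `r`): `4 M(Λ_r) ≥ E^ℍ|K_max(Λ_r)| ≥ ⌊r/2⌋/6` and `M(Λ_r) ≥ 2`. [folklore] -/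
theorem typicalMax_halfBox_ge_linear (r : ℕ) :
    (r : ℝ) / 96 ≤ (typicalMax (floorDilutedPercolation 3 (criticalProbI 3) 1) (halfBox r) : ℝ) := by
  set P := floorDilutedPercolation 3 (criticalProbI 3) 1 with hP
  set M := typicalMax P (halfBox r) with hM
  have hM2 : (2 : ℝ) ≤ M := by exact_mod_cast two_le_typicalMax P (halfBox_nonempty r)
  have h4 : ∫ ω, (clusterMaxIn (halfBox r) ω : ℝ) ∂P ≤ 4 * (M : ℝ) :=
    integral_clusterMaxIn_le_four_mul_typicalMax (floorDilutedParam 3 (criticalProbI 3) 1) (halfBox_nonempty r)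
  have ht : (((r / 2 : ℕ)) : ℝ) / 6 ≤ ∫ ω, (clusterMaxIn (halfBox r) ω : ℝ) ∂P :=
    integral_clusterMaxIn_halfBox_ge (Nat.mul_div_le r 2)
  have hdiv : ((r : ℝ) - 1) / 2 ≤ ((r / 2 : ℕ) : ℝ) := by
    have h1 : r ≤ r / 2 * 2 + 1 := by omega
    have h2 : (r : ℝ) ≤ (r / 2 : ℕ) * 2 + 1 := by exact_mod_cast h1
    linarith
  have hlin : ((r : ℝ) - 1) / 48 ≤ M := by linarith
  by_cases hr : (r : ℝ) ≤ 96
  · linarith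
  · push Not at hr
    linarith

/-- **The `ρ = 1` slice of stub G** (registered form): `∃ c > 0, ∀ r ≥ 1, c r ≤ M(Λ_r)` at `p_c(ℤ³)` (`c = 1/96`). [folklore] -/
theorem typicalMax_halfBox_linear_lower :
    ∃ c : ℝ, 0 < c ∧ ∀ r : ℕ, 1 ≤ r →
      c * (r : ℝ) ≤ (typicalMax (floorDilutedPercolation 3 (criticalProbI 3) 1) (halfBox r) : ℝ) := by
  refine ⟨1 / 96, by norm_num, fun r _ => ?_⟩
  have := typicalMax_halfBox_ge_linear r
  linarith

end Summit.CriticalPhenomena.PercolationContinuityZ3.Theorems.TallClusterMassBound.OnesidedHalves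

end
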